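import Literature.RingTheory.FormalGroups.FormalOModuleLaw
import Literature.RingTheory.FormalGroups.FormalOModuleKernelPoints
import Literature.RingTheory.FormalGroups.FormalGroupHomAdd
import Literature.AlgebraicGeometry.GroupSchemes.BarsottiTateGroupHom
import Literature.AlgebraicGeometry.GroupSchemes.BTGroupNilpotentPoints
import Summits.HodgeConjecture.HodgeConjecture.Theorems.F0P6dFormalModuleKernels
import Summits.HodgeConjecture.HodgeConjecture.Theorems.F0P6dStubHLD
import Mathlib.RingTheory.Nilpotent.Basic
import Mathlib.RingTheory.Polynomial.Quotient
import HarnessLib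

/-!
# `F0P6dConnectedBTDictionary` — ★ RE-HOME (rung-0 re-homing task, books INVENTORY §8.4 M-3; LEAD F0P6-plan (g4) «M-72») of the crux workfile `Lines/F0_P6d_ConnectedBTDictionary.lean`

This `Theorems/` module is the TREE BYTES of `Summits/HodgeConjecture/HodgeConjecture/Cruxes/HLiu418/Lines/F0_P6d_ConnectedBTDictionary.lean` (edition of record,
tree sha16 675dbed9a71d921a, 175 l., code-`sorry`-free) with the NAMESPACE KEPT — `Summit.HodgeConjecture.HodgeConjecture.Cruxes.HLiu418.F0P6dConnectedBTDictionary` — so that every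
fully-qualified name (`ConnectedDimOneIsOModuleLaw`, `KernelSubfunctorOfHeight`, `OrdSSKernelsOnBT`, `stub_HLD`, `stub_HLE`, `tangentChar_uniformizer_eq_zero`, `ordSSKernelsOnBT_of_stubs`, `stub_HLBT_holds`; 8 declarations) is UNCHANGED; only this module
docstring is re-headed and the `Lines` imports are switched to their ★ re-homed twins (`F0_P6d_FormalModuleKernels` → `Theorems.F0P6dFormalModuleKernels`).  Why a re-home: a `Theorems/` file cannot import a `Lines/` workfile (F0P6-ref1 o-6), and closing
stmt-HodgeConjecture-24832 `--as proved --by <Theorems decl>` at rung 0 needs the sorry-free Lines chain behind the gate (RE-HOME MAP v1.1, LA7-plan (g4),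
2026-09-02; director g27 s1336 (R1)–(R3)).    Lines importers of the original: none.
After this file is ★ the Lines workfile is meant to become a one-import SHIM of it (a `Lines/` write, batched per cone on the LEAD's word), so no
environment ever holds two copies (NO-CROSS-IMPORT rule, «M-72» (3)).  It asserts nothing beyond what the workfile already proves.

## Original module docstring (verbatim)
# Crux `HLiu418` — P6 «MOD programme», door P″ — SUB-LINE 2 of desk P6d: **F0-P6d ConnectedBTDictionary**
# «a connected one-dimensional `p`-divisible group with `𝒪`-action over a field IS the torsion of a formal `𝒪`-module law»
# (LEAD M-1a (3): «(b2)∕(b3a) live on ★ `FormalOModuleLaw.IsOfHeight` + the dictionary law ⟷ connected `p`-divisible group of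
# `𝒪`-height `h` over κ̄: `ker [ϖ] = ker F_{q^h}` as closed subschemes»)

SKELETON v1 (F0P6d-plan (g0), 2026-09-01; ED. 2∕3 = `stub_HLE` proved in file over ★ p844675, predicates from ★ p844872; **ED. 4 = ED. 3 +
`stub_HLD` PAID BY NAME** by ★ `Theorems/F0P6dStubHLD.lean` (F0P6-p06 (g0)) — **THE SUB-LINE IS SORRY-FREE**: `stub_HLBT_holds : OrdSSKernelsOnBT p H`
is a theorem).  Cell `hodgecm-mathlib`, floor 0 ∕ D-0175, crux item stmt-HodgeConjecture-24832
(`HCCMUnconditional.HLiu418`).  Sister sub-line 1 `Lines/F0_P6d_FormalModuleKernels.lean` (HL-A height dichotomy, HL-B∕HL-C kernels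
`([ϖ^m]_F) = (X^{q^{hm}})` on ★ `FormalOModuleLaw`) is the POWER-SERIES side; this file is the FIELD CASE of the desk's banked BT ⟷ law
dictionary (`F0/P6/F0P6d-plan/F0_P6d_LubinTateFormalModuli.cand.v5.*` §2⅝), re-typed on the carriers LEAD named: ★ `BTGroup (Spec k) p H`
(`Literature/AlgebraicGeometry/GroupSchemes/BarsottiTateGroup{,Hom}` p844422∕p844437 — the currency of ★ `AbelianScheme.pDivisibleGroup`
(F5) and `pDivisibleGroupMap`, so an `𝒪`-action on the abelian scheme gives `β : 𝒪 → BTGroup.Hom B B` by functoriality), nilpotent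
POINTS of `k`-algebras (`(Spec R → B.G n) ≃ {x ∈ Nil R ∣ [pⁿ]_F x = 0}` — Yoneda-complete for the finite layers), ★ `FormalOModuleLaw 𝒪 k`.
HC_CM is proved only modulo the printed citations until rung 0 closes; nothing in this file is about HC.

## Letters
* (HL-D) `ConnectedDimOneIsOModuleLaw p H` — over a field `k` with `p = 0`, a BT group `B` of height `H ≥ 1` that is CONNECTED OF
  DIMENSION ONE (`Γ(B.G n) ≃ₐ[k] k[X]⧸(X^{p^{nH}})` for all `n`) with a ring action `β : 𝒪 → End B` is the `p`-power torsion of a formal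
  `𝒪`-module law: `∃ χ : 𝒪 →+* k` (the tangent character), `∃ M : FormalOModuleLaw 𝒪 k` (for `χ.toAlgebra`) and comparison bijections
  `e n R : (Spec R → B.G n) ≃ TorsPts M.toFormalGroup p n R`, natural in `R`, carrying `μ` to `F`-addition, `incl` to inclusion and `β a` to
  `[a]_F` (`IsPTorsionOfOLawVia`).  (L: over a field, [Tate1967] §2.2 Prop. 1 ∕ [Messing1972] II (3.3.18) «connected `p`-divisible ⟺ divisible
  formal Lie group»; dimension one from the layer algebras; `χ(a) := [a]′(0)`.)
* (HL-E) `KernelSubfunctorOfHeight p H` — UNDER such a dictionary, if `[ϖ]_F` has the height normal form `M.IsOfHeight ϖ q h` then for all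
  `m, n` and every point `f : Spec R → B.G n`: `f ∘ β(ϖ^m) ↦ 0` iff `x^{q^{hm}} = 0` where `x = e f` — i.e. the sub-functor `ker β(ϖ^m)` of
  `B.G n` is `{x ∣ x^{q^{hm}} = 0} = ker F_{q^{hm}}`; ORD `h = 1`: `ker [ϖ] = ker F_q`, SS `h = 2`: `ker [ϖ] = ker F_{q²}`.  (S: the
  dictionary clause + sub-line 1's HL-C `KernelPointsOfHeight`.)
* target `OrdSSKernelsOnBT p H` + KERNEL-CHECKED `ordSSKernelsOnBT_of_stubs : ConnectedDimOneIsOModuleLaw → HeightDichotomy (sub-line 1, BY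
  IMPORT) → KernelSubfunctorOfHeight → OrdSSKernelsOnBT` and head `stub_HLBT_holds` from `stub_HLD`, sub-line 1's `stub_HLA`, `stub_HLE` BY NAME.

## Registered stubs (2): `stub_HLD` (L), `stub_HLE` (S) — ED. 2∕3: `stub_HLE` PROVED IN FILE (3 lines over ★ p844675
`FormalOModuleLaw.kernelPointsOfHeight` through the action clause of `IsPTorsionOfOLawVia`; F0P3b-p01's cert `CERT-HLE-stub_HLE-3line-fold`);
ED. 4: `stub_HLD` PAID BY NAME by ★ `F0P6dStubHLD.connectedDimOneIsOModuleLaw` (F0P6-p06 (g0): «Yoneda with universal nilpotent points» —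
coordinates ★ p845010 (A-p17) ⇒ per-layer laws and buds ★ `GroupObject{Laws,Buds,Associativity}FromCoordinates` (F0P6-p06, B-p12) ⇒ tangent
character + formal `𝒪`-module law of the tower ★ p845050∕p845078 (F0P6-p06) ⇒ dictionary ★ p845025 (A-p17)); sorries left: **0**.  NOT in this file: which `h` occurs (HEART∕DICT); (b1)(b3b)(b4) (P6b: sub-line
`F0_P6b_ConnectedEtale`, ★ `FormalGroupFrobeniusKernel` p844642 «one closed subgroup scheme per `p`-power order»).

## REUSE MAP
★ `GroupSchemes/BarsottiTateGroup{,Hom,BaseChange}` (`BTGroup`, `grpObj`, `incl`, `Hom.app∕comp∕id`), ★ `AbelianSchemes/PDivisibleGroupOfAbelianScheme`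
(`pDivisibleGroup : BTGroup S p (2g)`) ∕ `PDivisibleGroupFunctor` (`pDivisibleGroupMap`) — HEART's side; ★ `FormalGroups/FormalOModuleLaw`,
`FormalGroupHomAdd` (`nsmulHom` = `[m]_F`); Mathlib `CategoryTheory.Monoidal.Cartesian.Grp_` (`GrpObj`, `μ`, `lift`), `AlgebraicGeometry.Spec`∕`Over`,
`RingTheory.Nilpotent`, `RingTheory.Polynomial.Quotient`.

## References
[Tate1967] J. Tate, *p-divisible groups* (Driebergen 1966), §2.2 Prop. 1 · [Messing1972] LNM 264, Ch. II (3.3.18) (acq-14350) ·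
[HarrisTaylorAMS2001] §II.1 · [Frohlich1968] I §3.
-/

set_option autoImplicit false
set_option linter.dupNamespace false

noncomputable section

namespace Summit.HodgeConjecture.HodgeConjecture.Cruxes.HLiu418.F0P6dConnectedBTDictionary

universe u v

open AlgebraicGeometry CategoryTheory MonObj CartesianMonoidalCategory
open Literature.AlgebraicGeometry.GroupSchemes -- ★ `BTGroup`, and (ED. 3) the organ's `TorsPts` `specOver` `IsPTorsionOfLawVia` `IsPTorsionOfOLawVia` `IsRingActionBT` `IsConnectedDimOne`
open Literature.RingTheory.FormalGroups (FormalGroupHom FormalOModuleLaw evalNilp evalNilp₂)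
open Summit.HodgeConjecture.HodgeConjecture.Cruxes.HLiu418.F0P6dFormalModuleKernels (HeightDichotomy stub_HLA)

/-! ## §1 Points currency — ED. 3: the predicates `TorsPts`, `specOver`, `IsPTorsionOfLawVia`, `IsPTorsionOfOLawVia`, `IsRingActionBT`,
`IsConnectedDimOne` now come BY NAME from the ★ DEF organ `Literature/AlgebraicGeometry/GroupSchemes/BTGroupNilpotentPoints.lean` (F0P6-p06 (g0);
their texts = ED. 1∕2's inline texts VERBATIM, ref1 LIGHT BOX «organ (E2)» 14:06:38Z script-checked), over ★ `NilpotentEvaluation.evalNilp∕evalNilp₂`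
(p844664 = the lines' inline texts).  The letters below are token-identical to ED. 1∕2; only the constants they resolve to moved to `Literature/`,
so that the HL-D closer can be a `Literature/` ∕ `Theorems/` theorem (a Theorems file cannot import a `Cruxes/…/Lines` module). -/

/-- LETTER (HL-D) **CONNECTED ONE-DIMENSIONAL BT GROUPS WITH `𝒪`-ACTION OVER A FIELD ARE FORMAL `𝒪`-MODULE LAWS** (L). Over a
field `k` with `p = 0`, for `B` of height `H ≥ 1` connected of dimension one and a ring action `β : 𝒪 → End B`: there are a ring map
`χ : 𝒪 → k` (tangent character `a ↦ [a]′(0)`), a formal `𝒪`-module law `M` over `k` (for the algebra structure `χ`) and comparison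
bijections identifying `B` with `M[p^∞]` and `β` with `[·]_M` on nilpotent points.
[cite: Tate1967, §2.2 Prop. 1] [cite: Messing1972, Ch. II (3.3.18)] -/
def ConnectedDimOneIsOModuleLaw (p H : ℕ) : Prop :=
  ∀ (k : Type u) [Field k], (p : k) = 0 → 0 < H → ∀ (B : BTGroup (Spec (.of k)) p H), IsConnectedDimOne B →
    ∀ (𝒪 : Type v) [CommRing 𝒪] (β : 𝒪 → BTGroup.Hom B B), IsRingActionBT B β →
      ∃ χ : 𝒪 →+* k, letI := χ.toAlgebra
      ∃ M : FormalOModuleLaw 𝒪 k, haveI := M.isComm'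
      ∃ e : ∀ (n : ℕ) (R : Type u) [CommRing R] [Algebra k R], (specOver R ⟶ B.G n) ≃ TorsPts M.toFormalGroup p n R,
        IsPTorsionOfOLawVia 𝒪 M.toFormalGroup M.act p B β e

/-- LETTER (HL-E) **KERNEL OF `β(ϖ^m)` = KERNEL OF THE `q^{hm}`-FROBENIUS, READ ON `B`** (S given sub-line 1's HL-C): under a dictionary
`e` matching `β` with `[·]_M`, if `[ϖ]_M` has the height normal form `M.IsOfHeight ϖ q h` (`0 < q`), then a point `f : Spec R → B.G n` is
killed by `β(ϖ^m)` (its image corresponds to `0`) iff its coordinate `x = e f` satisfies `x^{q^{hm}} = 0`.  ORD `h = 1`, `m = 1`: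
`ker [ϖ] = ker F_q`; SS `h = 2`: `ker [ϖ] = ker F_{q²}` — as sub-functors of `B.G n` on all `k`-algebras, hence as closed subschemes.
[cite: HarrisTaylorAMS2001, §II.1 p. 59] [cite: Frohlich1968, Ch. I §3 Thm. 2] -/
def KernelSubfunctorOfHeight (p H : ℕ) : Prop :=
  ∀ (k : Type u) [Field k] (B : BTGroup (Spec (.of k)) p H) (𝒪 : Type v) [CommRing 𝒪] [Algebra 𝒪 k]
    (M : FormalOModuleLaw 𝒪 k) (β : 𝒪 → BTGroup.Hom B B),
    (haveI := M.isComm'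
     ∀ (e : ∀ (n : ℕ) (R : Type u) [CommRing R] [Algebra k R], (specOver R ⟶ B.G n) ≃ TorsPts M.toFormalGroup p n R),
      IsPTorsionOfOLawVia 𝒪 M.toFormalGroup M.act p B β e →
      ∀ (ϖ : 𝒪) (q h : ℕ), 0 < q → M.IsOfHeight ϖ q h →
        ∀ (m n : ℕ) (R : Type u) [CommRing R] [Algebra k R] (f : specOver R ⟶ B.G n),
          ((e n R) (f ≫ (β (ϖ ^ m)).app n)).1 = 0 ↔ ((e n R) f).1 ^ (q ^ (h * m)) = 0)

/-- TARGET LETTER **ORD ∕ SS KERNELS READ ON THE BT GROUP**: over a field `k` with `p = 0`, let `B` (height `H ≥ 1`) be connected of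
dimension one with a ring action `β` of `𝒪` — a DVR with finite residue field of cardinality `q`, uniformiser `ϖ`, and `p ∣ ϖ^e` for some
`e` (mixed characteristic `(0, p)`).  Then `B ≅ M[p^∞]` for a formal `𝒪`-module law `M` over `k` (dictionary `e`), and EITHER `[ϖ]_M = 0` OR
there is an `𝒪`-height `h ≥ 1` with `M.IsOfHeight ϖ q h` such that for all `m, n` the points of `B.G n` killed by `β(ϖ^m)` are exactly those
with coordinate `x`, `x^{q^{hm}} = 0`: `ker [ϖ^m] = ker F_{q^{hm}}` — ORD `h = 1`: `ker [ϖ] = ker F_q`, SS `h = 2`: `ker [ϖ] = ker F_{q²}`.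
Proved below from HL-D, sub-line 1's HL-A ∕ HL-C, and HL-E BY NAME. [cite: HarrisTaylorAMS2001, §II.1 p. 59] [cite: Tate1967, §2.2] -/
def OrdSSKernelsOnBT (p H : ℕ) : Prop :=
  ∀ (k : Type u) [Field k], (p : k) = 0 → 0 < H → ∀ (B : BTGroup (Spec (.of k)) p H), IsConnectedDimOne B →
    ∀ (𝒪 : Type v) [CommRing 𝒪] [IsDomain 𝒪] [IsDiscreteValuationRing 𝒪] [Finite (IsLocalRing.ResidueField 𝒪)] (ϖ : 𝒪),
      Irreducible ϖ → (∃ e : ℕ, (p : 𝒪) ∣ ϖ ^ e) → ∀ (β : 𝒪 → BTGroup.Hom B B), IsRingActionBT B β →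
      ∃ χ : 𝒪 →+* k, letI := χ.toAlgebra
      ∃ M : FormalOModuleLaw 𝒪 k, haveI := M.isComm'
      ∃ e : ∀ (n : ℕ) (R : Type u) [CommRing R] [Algebra k R], (specOver R ⟶ B.G n) ≃ TorsPts M.toFormalGroup p n R,
        IsPTorsionOfOLawVia 𝒪 M.toFormalGroup M.act p B β e ∧
        ((M.act ϖ).toPowerSeries = 0 ∨
          ∃ h, 0 < h ∧ M.IsOfHeight ϖ (Nat.card (IsLocalRing.ResidueField 𝒪)) h ∧
            ∀ (m n : ℕ) (R : Type u) [CommRing R] [Algebra k R] (f : specOver R ⟶ B.G n),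
              ((e n R) (f ≫ (β (ϖ ^ m)).app n)).1 = 0 ↔
                ((e n R) f).1 ^ (Nat.card (IsLocalRing.ResidueField 𝒪) ^ (h * m)) = 0)

/-! ## §3 Registered stubs -/

/-- (HL-D) registered stub — connected one-dimensional BT groups with `𝒪`-action over a field are formal `𝒪`-module laws (L) —
**PAID BY NAME at ED. 4** by ★ `F0P6dStubHLD.connectedDimOneIsOModuleLaw` (`Theorems/F0P6dStubHLD.lean`, F0P6-p06 (g0), the HL-D
closer assembling ★ (S) `BTGroup.exists_coordinates_of_isConnectedDimOne` p845010 (A-p17), ★ (P1)(P2) `GroupObjectLawsFromCoordinates` ∕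
`GroupObjectBudsFromCoordinates` (F0P6-p06), ★ (P3) `GroupObjectAssociativityFromCoordinates` p845038 (B-p12), ★ (P4) `FormalOModuleLawOfTower`
p845050 + `BTGroupOModuleLawOfCoordinates` p845078 (F0P6-p06), ★ (P5) `BTGroupDictionaryOfCoordinates` p845025 (A-p17); the instance
`[Fact p.Prime]` of the stub is idle). [cite: Tate1967, §2.2 Prop. 1] [cite: Messing1972, Ch. II (3.3.18)] -/
theorem stub_HLD (p H : ℕ) [Fact p.Prime] : ConnectedDimOneIsOModuleLaw.{u, v} p H :=
  F0P6dStubHLD.connectedDimOneIsOModuleLaw p H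

/-- (HL-E) registered stub — kernel of `β(ϖ^m)` on `B` = `{x ∣ x^{q^{hm}} = 0}` under the dictionary (S, from sub-line 1's HL-C).
[cite: HarrisTaylorAMS2001, §II.1 p. 59] -/
theorem stub_HLE (p H : ℕ) [Fact p.Prime] : KernelSubfunctorOfHeight.{u, v} p H := by
  intro k _ B 𝒪 _ _ M β e hVia ϖ q h hq hM m n R _ _ f
  rw [hVia.2 (ϖ ^ m) n R f]
  exact Literature.RingTheory.FormalGroups.FormalOModuleLaw.kernelPointsOfHeight 𝒪 k M ϖ q h hq hM m R
    ((e n R) f).1 ((e n R) f).2.1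

/-! ## §4 Head (sorry-free composition; sub-line 1's letters enter BY NAME through the import) -/

/-- The tangent character kills the uniformiser: `χ(ϖ)^e = χ(p)·χ(c) = 0` in the field `k` of characteristic `p`. -/
theorem tangentChar_uniformizer_eq_zero {k : Type u} [Field k] {𝒪 : Type v} [CommRing 𝒪] (p : ℕ) (hp : (p : k) = 0)
    (χ : 𝒪 →+* k) (ϖ : 𝒪) (hmix : ∃ e : ℕ, (p : 𝒪) ∣ ϖ ^ e) : χ ϖ = 0 := by
  obtain ⟨e, c, hc⟩ := hmix
  have h0 : χ ϖ ^ e = 0 := by rw [← map_pow, hc, map_mul, map_natCast, hp, zero_mul]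
  exact pow_eq_zero_iff'.mp h0 |>.1

/-- KERNEL-CHECKED COMPOSITION: HL-D (dictionary) + HL-A (height dichotomy, sub-line 1) + HL-E (kernel sub-functor) ⇒ `OrdSSKernelsOnBT`. -/
theorem ordSSKernelsOnBT_of_stubs (p H : ℕ) (hD : ConnectedDimOneIsOModuleLaw.{u, v} p H) (hA : HeightDichotomy.{v, u})
    (hE : KernelSubfunctorOfHeight.{u, v} p H) : OrdSSKernelsOnBT.{u, v} p H := by
  intro k _ hp hH B hB 𝒪 _ _ _ _ ϖ hϖ hmix β hβ
  obtain ⟨χ, M, e, hdict⟩ := hD k hp hH B hB 𝒪 β hβ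
  letI : Algebra 𝒪 k := χ.toAlgebra
  haveI := M.isComm'
  have hχ : algebraMap 𝒪 k ϖ = 0 := tangentChar_uniformizer_eq_zero p hp χ ϖ hmix
  refine ⟨χ, M, e, hdict, ?_⟩
  rcases hA 𝒪 ϖ hϖ k hχ M with h0 | ⟨h, hh, hMh⟩
  · exact Or.inl h0
  · refine Or.inr ⟨h, hh, hMh, fun m n R _ _ f => ?_⟩
    exact hE k B 𝒪 M β e hdict ϖ _ h Nat.card_pos hMh m n R f

/-- HEAD — `OrdSSKernelsOnBT` from the registered stubs BY NAME (sub-line 1's `stub_HLA` enters by import). -/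
theorem stub_HLBT_holds (p H : ℕ) [Fact p.Prime] : OrdSSKernelsOnBT.{u, v} p H :=
  ordSSKernelsOnBT_of_stubs p H (stub_HLD p H) stub_HLA (stub_HLE p H)

end Summit.HodgeConjecture.HodgeConjecture.Cruxes.HLiu418.F0P6dConnectedBTDictionary
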